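import Mathlib
import Summits.AnomalousDissipation.AnomalousDissipation.Theorems.SoloBlindLinearFlowPerturbation

/-!
# Continuity of the monodromy in parameters (solo-blind s80, §24.90(12))

The bridge between kernel #143 (`linear_flow_perturbation'`: two linear flows whose generators
differ by `≤ ε` differ by `≤ ε R t e^{K t}`) and kernel #142 (`resolvent_bound_near_slice`, whose
input is joint continuity of `(P, z) ↦ M(P, z)`): if the generator `A p t` depends on the parameter
`p` continuously, uniformly in `t ∈ [0, T)`, and the flows `U p` are uniformly bounded, then the
time-`T` map `p ↦ U p T` (the monodromy) is continuous on the parameter set.  With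
`p = (P, z) ∈ S ×ˢ closedBall z₀ r` this is exactly the continuity hypothesis of #142.

* `monodromy_continuousOn` — the statement above.
-/

open Set Metric Real

namespace Summit.AnomalousDissipation.AnomalousDissipation.Theorems

variable {𝔸 : Type*} [NormedRing 𝔸] [NormedAlgebra ℝ 𝔸]
variable {P : Type*} [PseudoMetricSpace P]

/-- **The monodromy is continuous in the parameters.**  For `p` in a parameter set `D` let
`U p` solve `(U p)' = A p t * U p t` on `[0, T]` (right derivatives, `U p` continuous), all with the
same initial value, with `‖A p t‖ ≤ K` and `‖U p t‖ ≤ R` on `[0, T)`, and let `p ↦ A p` be continuous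
on `D` uniformly in `t ∈ [0, T)`.  Then `p ↦ U p T` is continuous on `D`. -/
theorem monodromy_continuousOn {A U : P → ℝ → 𝔸} {D : Set P} {T K R : ℝ} (hT : 0 ≤ T)
    (hK : 0 ≤ K) (hR : 0 ≤ R)
    (hUc : ∀ p ∈ D, ContinuousOn (U p) (Icc 0 T))
    (hU' : ∀ p ∈ D, ∀ t ∈ Ico 0 T, HasDerivWithinAt (U p) (A p t * U p t) (Ici t) t)
    (h0 : ∀ p ∈ D, ∀ q ∈ D, U p 0 = U q 0)
    (hA : ∀ p ∈ D, ∀ t ∈ Ico 0 T, ‖A p t‖ ≤ K)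
    (hUR : ∀ p ∈ D, ∀ t ∈ Ico 0 T, ‖U p t‖ ≤ R)
    (hAc : ∀ p ∈ D, ∀ ε > 0, ∃ δ > 0, ∀ q ∈ D, dist q p < δ → ∀ t ∈ Ico 0 T, ‖A q t - A p t‖ ≤ ε) :
    ContinuousOn (fun p => U p T) D := by
  rw [Metric.continuousOn_iff]
  intro p hp ε hε
  -- choose the generator tolerance ε' with ε' R T e^{KT} < ε
  set L : ℝ := R * T * exp (K * T) + 1 with hL
  have hLpos : 0 < L := by have := mul_nonneg (mul_nonneg hR hT) (exp_pos (K * T)).le; linarith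
  obtain ⟨δ, hδ, hδA⟩ := hAc p hp (ε / (2 * L)) (by positivity)
  refine ⟨δ, hδ, fun q hq hqp => ?_⟩
  have hqA : ∀ t ∈ Ico 0 T, ‖A q t - A p t‖ ≤ ε / (2 * L) := hδA q hq hqp
  have key := linear_flow_perturbation' (A := A p) (B := A q) (U := U p) (W := U q) hK
    (by positivity : 0 ≤ ε / (2 * L)) hR (hUc p hp) (hUc q hq) (hU' p hp) (hU' q hq) (h0 p hp q hq)
    (hA p hp) hqA (hUR q hq) T ⟨hT, le_rfl⟩
  rw [dist_eq_norm, norm_sub_rev]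
  calc ‖U p T - U q T‖ ≤ ε / (2 * L) * R * T * exp (K * T) := key
    _ = ε / (2 * L) * (R * T * exp (K * T)) := by ring
    _ ≤ ε / (2 * L) * L := by
        apply mul_le_mul_of_nonneg_left _ (by positivity)
        rw [hL]; linarith
    _ = ε / 2 := by field_simp
    _ < ε := by linarith

end Summit.AnomalousDissipation.AnomalousDissipation.Theorems
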